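import Summits.Schanuel.Schanuel.Theorems.DiophantineDichotomyApproximationPropertyDefs
import Summits.Schanuel.Schanuel.Theorems.DiophantineDichotomyApproximationPropertyCycleAPITwoLemmas
import Literature.NumberTheory.Transcendental.NesterenkoEliminationProp411Holds
import Literature.NumberTheory.Transcendental.PhilipponCriterionPrincipal
import Literature.NumberTheory.Transcendental.PhilipponCriterionHomogenization
import Literature.RingTheory.GradedAlgebra.HomogeneousAssociatedPrimes
import HarnessLib

/-!
# Stub F of line `orbit-interpolation-determinant`: `CycleAPIAt 2` from the plane construction (crux `ApproximationProperty`, stmt-Schanuel-6117)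

Route `DiophantineDichotomy` (sub-problem `Schanuel/Schanuel`), crux
`Summit.Schanuel.Schanuel.Theses.DiophantineDichotomy.ApproximationProperty`, line
`orbit-interpolation-determinant`, skeleton v4, registered stub `stub_cycleAPI_two_of`: the 0-cycle
approximation property with interpolation control in dimension `2` (`CycleAPIAt 2` of the definitions
module) FROM the three inputs of the plane construction, taken as hypotheses (they are the registered
stubs B, C, E of the skeleton, proved in sibling files):

* (B) a small irreducible plane curve: for `Y ≥ Δ ≥ c₁(ω)` a prime principal ideal `(Q)`,
  `deg Q = a ≤ Δ`, `h((Q)) ≤ 10Y`, `log |(Q)(1:ω)| ≤ −(Δ/c₁)(Δ(h((Q)) + a) + Y a)`;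
* (C) the box principle modulo a curve: a form `R ∉ (Q)` of degree `b ≥ max(a, 10)`, integer
  coefficients `≤ N`, `|R(1:ω)| ≤ exp(c₂ b − (ab/8) log(N+1))`;
* (E) the interpolation clause for homogeneous primes of rank `1` whose zeros lie on `V(Q) ∩ V(R)`,
  in every degree `s ≥ a + b`.

The proof is ONE hypersurface section (LNM 1752 Ch. 3 Prop. 4.11, the tree's
`NesterenkoPhilippon2001_ch3_prop_4_11_holds`, `m = r = 2`) with the ADAPTIVE height
`h₂ = max(Y, Δ h((Q))/a)` for the second form, and bookkeeping: `deg J ≤ ab ≤ Δ²`,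
`h(J) ≤ b h((Q)) + a h(R) + 6ab ≤ 27 ΔY`, and the accuracy
`log |J(1:ω)| ≤ log max(‖R‖, |(Q)|) + a h(R) + b h((Q)) + 44ab ≤ −(Δ h(J) + Y deg J)/c` with
`c = 4000 (c₁ + c₂ + 1)`. Proofs only; no definitions. Sources: Philippon, J. Number Theory 81 (2000)
(AP1, `n = 2`); Nesterenko, LNM 1752 Ch. 3 §4.
-/

set_option linter.dupNamespace false

noncomputable section

namespace Summit.Schanuel.Schanuel.Cruxes.ApproximationProperty.OrbitInterpolationDeterminant

open Literature.NumberTheory.Transcendental.Nesterenko MvPolynomial Module Real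
open Literature.NumberTheory.Transcendental (PhilipponMain.isUnmixedOfRank_span_singleton
  PhilipponMain.cons_one_ne_zero PhilipponMain.one_le_norm_cons_one)
open scoped BigOperators

attribute [local instance] MvPolynomial.gradedAlgebra


open CycleAPITwo in
/-- **Stub F — `CycleAPIAt 2` from the plane construction** (registered stub `stub_cycleAPI_two_of` of
skeleton v4 of line `orbit-interpolation-determinant`): the small irreducible plane curve (stub B), the
box principle modulo that curve with the ADAPTIVE height `h₂ = max(Y, Δ h((Q))/deg Q)` (stub C), one
hypersurface section by LNM 1752 Ch. 3 Prop. 4.11 (`NesterenkoPhilippon2001_ch3_prop_4_11_holds`,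
`m = r = 2`), and the interpolation clause for the associated primes of the resulting 0-cycle, whose
zeros lie on the plane complete intersection `V(Q) ∩ V(R)` (stub E at `s = ⌊cΔ⌋ ≥ a + b`); constant
`c = 4000 (c₁ + c₂ + 1)`. [cite: NesterenkoPhilippon2001, Ch. 3 Prop. 4.11 (pp. 40–41); Ch. 4 §4 (p. 61)] -/
theorem stub_cycleAPI_two_of :
    (∀ ω : Fin 2 → ℂ, ∃ c : ℝ, 1 ≤ c ∧ ∀ Δ Y : ℝ, c ≤ Δ → Δ ≤ Y →
      ∃ (Q : Rx 2) (a : ℕ), Q ≠ 0 ∧ Q.IsHomogeneous a ∧ 1 ≤ a ∧ (a : ℝ) ≤ Δ ∧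
        (Ideal.span {Q}).IsPrime ∧ ideg (Ideal.span {Q}) 2 = a ∧
        iheight (Ideal.span {Q}) 2 ≤ 10 * Y ∧
        iabs (Ideal.span {Q}) 2 (Fin.cons 1 ω) ≤
          Real.exp (-(Δ / c * (Δ * (iheight (Ideal.span {Q}) 2 + a) + Y * a)))) →
    (∀ ω : Fin 2 → ℂ, ∃ c : ℝ, 0 < c ∧ ∀ (Q : Rx 2) (a b N : ℕ), Q ≠ 0 → Q.IsHomogeneous a →
      1 ≤ a → a ≤ b → 10 ≤ b → 1 ≤ N →
      ∃ R : Rx 2, R ∉ Ideal.span {Q} ∧ R.IsHomogeneous b ∧ 1 ≤ maxNorm R ∧ maxNorm R ≤ N ∧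
        height R ≤ Real.log N ∧
        ‖aeval (Fin.cons 1 ω : Fin (2 + 1) → ℂ) R‖ ≤
          Real.exp (c * b - (a : ℝ) * b / 8 * Real.log ((N : ℝ) + 1))) →
    (∀ (Q R : Rx 2) (a b : ℕ), Q ≠ 0 → Q.IsHomogeneous a → R.IsHomogeneous b → 1 ≤ a → 1 ≤ b →
      (Ideal.span {Q}).IsPrime → R ∉ Ideal.span {Q} →
      ∀ 𝔮 : Ideal (Rx 2), 𝔮.IsPrime → 𝔮.IsHomogeneous (homogeneousSubmodule (Fin (2 + 1)) ℚ) →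
        IsUnmixedOfRank 𝔮 1 → projZeros 𝔮 ⊆ projZeros (Ideal.span {Q} ⊔ Ideal.span {R}) →
        ∀ s : ℕ, a + b ≤ s →
          Module.finrank ℚ ↥(homogeneousSubmodule (Fin (2 + 1)) ℚ s) =
            Module.finrank ℚ ↥(homogeneousSubmodule (Fin (2 + 1)) ℚ s ⊓ 𝔮.restrictScalars ℚ) +
              ideg 𝔮 1) →
    CycleAPIAt 2 := by
  intro hB hC hE ω
  classical
  obtain ⟨c₁, hc₁, hB⟩ := hB ω
  obtain ⟨c₂, hc₂, hC⟩ := hC ω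
  set ω₁ : Fin (2 + 1) → ℂ := Fin.cons 1 ω with hω₁def
  have hω₁ : ω₁ ≠ 0 := PhilipponMain.cons_one_ne_zero ω
  have hΘ : 1 ≤ ‖ω₁‖ := PhilipponMain.one_le_norm_cons_one ω
  -- the constant
  set c : ℝ := 4000 * (c₁ + c₂ + 1) with hcdef
  have hc4000 : 4000 ≤ c := by rw [hcdef]; nlinarith
  have hcc₁ : c₁ ≤ c := by rw [hcdef]; nlinarith
  have hc₂c : 80 * c₂ ≤ c := by rw [hcdef]; nlinarith
  have hc₁c : 50 * c₁ ≤ c := by rw [hcdef]; nlinarith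
  have hc1 : 1 ≤ c := by linarith
  have hc0 : 0 < c := by linarith
  refine ⟨c, hc1, fun Δ Y hΔ hY => ?_⟩
  have hΔ0 : 0 < Δ := by linarith
  have hY0 : 0 ≤ Y := by linarith
  -- stub B: the small prime curve `𝔭 = (Q)`
  obtain ⟨Q, a, hQ0, hQhom, ha1, haΔ, hQprime, hdegQ, hhQ, habsQ⟩ := hB Δ Y (hcc₁.trans hΔ) hY
  set 𝔭 : Ideal (Rx 2) := Ideal.span {Q} with h𝔭def
  set hp : ℝ := iheight 𝔭 2 with hpdef
  have hp0 : 0 ≤ hp := height_nonneg _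
  have ha1R : (1 : ℝ) ≤ a := by exact_mod_cast ha1
  have ha0R : (0 : ℝ) < a := by linarith
  -- the degree `b = ⌊Δ⌋` and the adaptive height `h₂`
  obtain ⟨hab, hb10, hbΔ, hΔb⟩ := floor_facts haΔ (by linarith : (10 : ℝ) ≤ Δ)
  set b : ℕ := ⌊Δ⌋₊ with hbdef
  have hb1 : 1 ≤ b := le_trans (by norm_num) hb10
  have hb0R : (0 : ℝ) ≤ b := Nat.cast_nonneg _
  set h₂ : ℝ := max Y (Δ * hp / a) with hh₂def
  have hYh₂ : Y ≤ h₂ := le_max_left _ _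
  have hh₂0 : 0 ≤ h₂ := hY0.trans hYh₂
  have hph₂ : Δ * hp ≤ a * h₂ := by
    have : Δ * hp / a ≤ h₂ := le_max_right _ _
    rw [div_le_iff₀ ha0R] at this
    linarith
  have hh₂le : h₂ ≤ Y + Δ * hp / a :=
    max_le (le_add_of_nonneg_right (by positivity)) (le_add_of_nonneg_left hY0)
  obtain ⟨hN1, hlogN, hlogN1⟩ := box_facts hh₂0
  set N : ℕ := ⌊exp h₂⌋₊ with hNdef
  -- stub C: the second form `R ∉ (Q)`
  obtain ⟨R, hRQ, hRhom, hR1, -, hhR, hRval⟩ := hC Q a b N hQ0 hQhom ha1 hab hb10 hN1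
  set hR : ℝ := height R with hRdef
  have hR0 : 0 ≤ hR := height_nonneg _
  have hRh₂ : hR ≤ h₂ := hhR.trans hlogN
  -- the normalised value of `R`
  have hnormR : normAt ω₁ R ≤ exp (c₂ * b - a * b * h₂ / 8) := by
    have h1 : normAt ω₁ R ≤ ‖aeval ω₁ R‖ := by
      rw [normAt]
      exact div_le_self (norm_nonneg _) (one_le_mul_of_one_le_of_one_le hR1 (one_le_pow₀ hΘ))
    refine h1.trans (hRval.trans (exp_le_exp.mpr ?_))
    have hab0 : 0 ≤ (a : ℝ) * b / 8 := by positivity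
    have := mul_le_mul_of_nonneg_left hlogN1 hab0
    have e : (a : ℝ) * b / 8 * h₂ = a * b * h₂ / 8 := by ring
    linarith
  -- Proposition 4.11: the 0-cycle `J`
  have hQu : ¬ IsUnit Q := fun hu => hQprime.ne_top (Ideal.span_singleton_eq_top.mpr hu)
  have hunm : IsUnmixedOfRank 𝔭 2 := PhilipponMain.isUnmixedOfRank_span_singleton hQ0 hQu
  have h𝔭hom : 𝔭.IsHomogeneous (homogeneousSubmodule (Fin (2 + 1)) ℚ) := by
    refine Ideal.homogeneous_span _ _ fun x hx => ?_
    rw [Set.mem_singleton_iff] at hx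
    subst hx
    exact ⟨a, hQhom⟩
  obtain ⟨J, hJhom, hJunm, hJzeros, hJdeg, hJh, hJabs⟩ :=
    (NesterenkoPhilippon2001_ch3_prop_4_11_holds 2 2 𝔭 R b (by norm_num) le_rfl hQprime h𝔭hom
      hunm hRhom hb1 hRQ).1 le_rfl
  simp only [show (2 : ℕ) - 1 = 1 from rfl, hdegQ] at hJunm hJdeg hJh hJabs
  have hJabs := hJabs ω₁ hω₁
  rw [← hpdef, ← hRdef] at hJh hJabs
  have hJh' : iheight J 1 ≤ hp * b + hR * a + 6 * a * b := by
    refine hJh.trans (le_of_eq ?_)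
    push_cast
    ring
  have hJabs' : iabs J 1 ω₁ ≤ bezoutDelta 𝔭 2 R ω₁ * exp (hR * a + hp * b + 44 * a * b) := by
    refine hJabs.trans (le_of_eq ?_)
    congr 1
    congr 1
    push_cast
    ring
  refine ⟨J, hJhom, hJunm, ?_, ?_, ?_, ?_⟩
  · -- degree budget `deg J ≤ ab ≤ Δ² ≤ (cΔ)²`
    have h1 : (ideg J 1 : ℝ) ≤ a * b := by exact_mod_cast hJdeg
    have h2 : (a : ℝ) * b ≤ Δ * Δ := mul_le_mul haΔ hbΔ hb0R hΔ0.le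
    have h3 : Δ * Δ ≤ (c * Δ) ^ 2 := by
      rw [sq]
      have : Δ ≤ c * Δ := le_mul_of_one_le_left hΔ0.le hc1
      exact mul_le_mul this this hΔ0.le (by positivity)
    linarith
  · -- height budget
    have hab' : (a : ℝ) ≤ Δ := haΔ
    have h := height_le (hR := hR) (by linarith : (27 : ℝ) ≤ c) hΔ hY hh₂le ha1R hab' hbΔ hb0R
      hhQ hRh₂
    have e : c * Y * Δ ^ (2 - 1) = c * Y * Δ := by norm_num
    rw [e]
    exact hJh'.trans h
  · -- accuracy
    have hT := arith_R (Y := Y) hc₂ hc₂c hc4000 hΔ hY hYh₂ hph₂ ha1R hbΔ hΔb hp0 hR0 hRh₂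
    have hP := arith_P (b := (b : ℝ)) hc₁ hc₁c hΔ hY hh₂le ha1R hbΔ hb0R hp0 hR0 hRh₂
    have hδ := bezoutDelta_le_max 𝔭 2 R ω₁
    -- the output-dependent target is weaker than the budgeted one
    have htarget : -((Δ * (hp * b + hR * a + 6 * a * b) + Y * (a * b)) / c) ≤
        -((Δ * iheight J 1 + Y * ideg J 1) / c) := by
      rw [neg_le_neg_iff]
      refine div_le_div_of_nonneg_right ?_ hc0.le
      have h1 : (ideg J 1 : ℝ) ≤ a * b := by exact_mod_cast hJdeg
      have e1 := mul_le_mul_of_nonneg_left hJh' hΔ0.le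
      have e2 := mul_le_mul_of_nonneg_left h1 hY0
      linarith
    refine hJabs'.trans ((mul_le_mul_of_nonneg_right hδ (exp_pos _).le).trans ?_)
    refine (max_mul_exp_le hnormR habsQ ?_ ?_).trans (exp_le_exp.mpr htarget)
    · linarith
    · have e : -(Δ / c₁ * (Δ * (hp + a) + Y * a)) = -(Δ / c₁ * (Δ * hp + Δ * a + Y * a)) := by ring
      rw [e]
      linarith
  · -- interpolation clause at `δ = ⌊cΔ⌋ ≥ a + b`
    intro 𝔮 h𝔮
    have h𝔮prime : 𝔮.IsPrime := h𝔮.1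
    have h𝔮hom : 𝔮.IsHomogeneous (homogeneousSubmodule (Fin (2 + 1)) ℚ) :=
      Literature.RingTheory.GradedAlgebra.isHomogeneous_of_mem_associatedPrimes _ hJhom h𝔮
    have h𝔮unm : IsUnmixedOfRank 𝔮 1 := isUnmixedOfRank_of_isPrime h𝔮prime (hJunm.2 𝔮 h𝔮)
    have h𝔮zeros : projZeros 𝔮 ⊆ projZeros (Ideal.span {Q} ⊔ Ideal.span {R}) := by
      rw [← hJzeros]
      exact projZeros_antitone (le_of_mem_associatedPrimes h𝔮)
    have hs : a + b ≤ ⌊c * Δ⌋₊ := by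
      refine Nat.le_floor ?_
      push_cast
      have : (a : ℝ) + b ≤ 2 * Δ := by linarith
      nlinarith
    exact hE Q R a b hQ0 hQhom hRhom ha1 hb1 hQprime hRQ 𝔮 h𝔮prime h𝔮hom h𝔮unm h𝔮zeros _ hs

end Summit.Schanuel.Schanuel.Cruxes.ApproximationProperty.OrbitInterpolationDeterminant

end
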